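import Summits.BirchSwinnertonDyer.BirchSwinnertonDyer.Theorems.ByReductionTypeAtTwoRankOneAtTwoOneDoorFirstDescentDefs
import Summits.BirchSwinnertonDyer.BirchSwinnertonDyer.Theorems.GenusKolyvaginAtTwoEquivariantKolyvaginExactAtTwoTwistLocalConditions
import Literature.NumberTheory.EllipticCurves.SelmerTorsionTwistRestriction
import HarnessLib

/-!
# Route ByReductionTypeAtTwo, crux `RankOneAtTwoBigImageOddLocal` (stmt-BirchSwinnertonDyer-23715), LINE v8.10 `one_door_analytic`:
# TRANSPORT of the Čebotarev fields of `FirstDescentInput` along an isomorphism of the twin (`V • X = Xd`)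

Lead prover seat `bsd-line-fkl-p1` g12 (2026-08-28), `--supports stmt-BirchSwinnertonDyer-23715` (helper).  THEOREMS ONLY; BSD is not proved by
any of this.

The bottom-rung datum carries an arbitrary globally minimal MODEL `Wd` of the twist (`Cd • W^{(d_K)} = Wd`), while route GenusKolyvaginAtTwo's
Čebotarev bricks (and the width seat's `ceb₂'_rat` / `ceb₂'_field…`) speak of the twist EQUATION `W^{(d_K)}`.  The record's local conditions
`locAt` / `strictAt` (`…OneDoorFirstDescentDefs.lean`) correspond under the induced `H¹(ℚ, X[2]) ≃ H¹(ℚ, Xd[2])` (`h1TorsionIso`, tree: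
`mem_selmerLocalKer_iff_h1TorsionIso_mem`, `mem_torsionLocalKer_iff_h1TorsionIso_mem`), so the cross field `ceb₂'` transports from `X` to `Xd`:
`locAt_iff_h1TorsionIso`, `strictAt_iff_h1TorsionIso`, `cross_field_of_iso`.

References: [SilvermanAEC2009] X.§4; [McCallumLMS1991] §3.
-/

set_option autoImplicit false
-- the Theorems namespace of this sub repeats the summit name by design (D-0017 nested layout)
set_option linter.dupNamespace false

noncomputable section

open scoped Classical

namespace Summit.BirchSwinnertonDyer.BirchSwinnertonDyer.Theorems.RankOneAtTwoOneDoor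

open WeierstrassCurve NumberField IsDedekindDomain Literature.NumberTheory.EllipticCurves Literature.NumberTheory.GaloisRepresentations
  Summit.BirchSwinnertonDyer.BirchSwinnertonDyer.Theorems.GenusExact
  Summit.BirchSwinnertonDyer.BirchSwinnertonDyer.Theorems.GenusExact.EigenClassesFinite

variable {X Xd : WeierstrassCurve ℚ} {V : VariableChange ℚ}

/-- `locAt` corresponds under `h1TorsionIso` (Kummer conditions of isomorphic curves, at every place). [cite: SilvermanAEC2009, X.§4] -/
theorem locAt_iff_h1TorsionIso (hV : V • X = Xd) (n : ℤ) (s : galH1Torsion X n) (v : RatPlace) :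
    s ∈ locAt X n v ↔ h1TorsionIso n hV s ∈ locAt Xd n v := by
  rcases v with v | w
  · rw [locAt_inl, locAt_inl]; exact mem_selmerLocalKer_iff_h1TorsionIso_mem n _ hV s
  · rw [locAt_inr, locAt_inr]; exact mem_selmerLocalKer_iff_h1TorsionIso_mem n _ hV s

/-- `strictAt` corresponds under `h1TorsionIso` (strict conditions of isomorphic curves, at every place). [cite: SilvermanAEC2009, X.§4] -/
theorem strictAt_iff_h1TorsionIso (hV : V • X = Xd) (n : ℤ) (s : galH1Torsion X n) (v : RatPlace) :
    s ∈ strictAt X n v ↔ h1TorsionIso n hV s ∈ strictAt Xd n v := by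
  rcases v with v | w
  · rw [strictAt_inl, strictAt_inl]; exact mem_torsionLocalKer_iff_h1TorsionIso_mem n _ hV s
  · rw [strictAt_inr, strictAt_inr]; exact mem_torsionLocalKer_iff_h1TorsionIso_mem n _ hV s

/-- **Transport of the cross Čebotarev field `ceb₂'` along `V • X = Xd`**: if every non-zero `s' ∈ H¹(ℚ, X[2])` relaxed off `q₀` admits a
Kolyvagin prime `ℓ` with `s'` not strict at `pl ℓ` and `y` not strict at `pl ℓ`, then so does every non-zero `s ∈ H¹(ℚ, Xd[2])` relaxed off
`q₀` (apply the hypothesis to `h1TorsionIso⁻¹ s`). [cite: McCallumLMS1991, §3 Cor. 3.2] [cite: SilvermanAEC2009, X.§4] -/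
theorem cross_field_of_iso (hV : V • X = Xd) {W : WeierstrassCurve ℚ} (Kol : ℕ → Prop) (pl : ℕ → RatPlace) (q₀ : RatPlace)
    (y : galH1Torsion W 2)
    (h : ∀ s' : galH1Torsion X 2, s' ≠ 0 → (∀ v : RatPlace, v ≠ q₀ → s' ∈ locAt X 2 v) →
      ∃ ℓ, Kol ℓ ∧ s' ∉ strictAt X 2 (pl ℓ) ∧ y ∉ strictAt W 2 (pl ℓ)) :
    ∀ s : galH1Torsion Xd 2, s ≠ 0 → (∀ v : RatPlace, v ≠ q₀ → s ∈ locAt Xd 2 v) →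
      ∃ ℓ, Kol ℓ ∧ s ∉ strictAt Xd 2 (pl ℓ) ∧ y ∉ strictAt W 2 (pl ℓ) := by
  intro s hs0 hs
  have hs' : (h1TorsionIso 2 hV).symm s ≠ 0 := fun h0 => hs0 (by simpa using congrArg (h1TorsionIso 2 hV) h0)
  have hloc : ∀ v : RatPlace, v ≠ q₀ → (h1TorsionIso 2 hV).symm s ∈ locAt X 2 v := fun v hv => by
    rw [locAt_iff_h1TorsionIso hV, AddEquiv.apply_symm_apply]; exact hs v hv
  obtain ⟨ℓ, hKol, hns, hny⟩ := h ((h1TorsionIso 2 hV).symm s) hs' hloc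
  refine ⟨ℓ, hKol, fun hmem => hns ?_, hny⟩
  rw [strictAt_iff_h1TorsionIso hV, AddEquiv.apply_symm_apply]
  exact hmem

end Summit.BirchSwinnertonDyer.BirchSwinnertonDyer.Theorems.RankOneAtTwoOneDoor

end
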